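import Mathlib
import HarnessLib
import Summits.CriticalPhenomena.PercolationContinuityZ3.Theorems.PercNearOneGluingNoHeavyLowerTailTwoCopyTwistedProduct

/-!
# THEOREM A: the two-copy graded Harris form is positive for terminal pairs of series–parallel networks

Helper file for crux `stmt-CriticalPhenomena-4575` (new-inequality factory `prim-ineq-gen-1`, gen 16); memo
`run/shared/lean/prim/prim-ineq-gen-1/FINDING-22-series-parallel.md` §1 (THEOREM A).  Builds on
`…TwoCopyTwistedProduct.lean` (good sides are closed under twisted products).

* `goodSide_edge`: the single edge (`Ω = Bool` = absent/present, `w false = q·q`, `w true = y·q`, event `id`) is a good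
  side when `0 ≤ q`, `0 ≤ y`;  `goodSide_const_true`: a side with trivial event is good (1-sums with anything).
* `SPTerm`, `SPTerm.side`: series–parallel TERMS (edge | ser | par) and their sides — configurations = one `Bool` per
  edge (iterated products, coordinatewise order = inclusion), event = 'terminals connected', weight = the random-cluster
  weight `Π_{e∈ω} y_e · q^{k(ω)}` of the two-terminal network times the normalising power `q^{#ser + 2·#par}`
  (series: `k = k₁ + k₂ − 1`; parallel: `k = k₁ + k₂ − 2 + [c₁][c₂]`, the twist `q^{[c₁][c₂]}`).
* `SPTerm.goodSide`, `SPTerm.harrisForm_nonneg` = THEOREM A: for every series–parallel term with nonnegative edge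
  weights and `0 ≤ q`, and every up-set `V` of configurations, `P(V)·(P(⊤)+Q(⊤)) − P(⊤)·(P(V)+Q(V)) ≥ 0`, i.e.
  `Z[x~y ∧ V]·Z − Z[x~y]·Z[V] ≥ 0`.  In `R = ℤ[q, (y_e)]` with the coefficientwise order (where multiplication by `q`
  reflects the order, so the normalisation is immaterial) this says: for every two-terminal series–parallel network and
  every increasing event `𝒱` the polynomial `Z[x~y ∧ 𝒱]·Z − Z[x~y]·Z[𝒱]` has nonnegative coefficients in `q` AND in all
  edge variables.  Consequences recorded in the memo: graded edge negative regression for the `q < 1` random-cluster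
  model on every `K₄`-minor-free graph (with `…TwoCopyEdgeBridge.lean`; Wagner 2008 had the edge–edge case), the
  two-point function of a TTSP pair is positively correlated with every increasing event at every `q > 0`, and
  sharpness (the fibrewise form fails exactly off the series–parallel class: Wheatstone bridge).
-/

namespace Summit.CriticalPhenomena.PercolationContinuityZ3.Theorems

namespace TwoCopySeriesParallel

open Finset TwoCopyTwistedProduct

variable {R : Type*} [CommRing R] [PartialOrder R] [IsOrderedRing R]

section ConstTrue

variable {Ω : Type*} [Fintype Ω] [Preorder Ω]

omit [IsOrderedRing R] in
/-- A side whose event is identically `true` is good as soon as its weights are nonnegative (used for 1-sums with an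
arbitrary second factor). [this work] -/
theorem goodSide_const_true (w : Ω → R) (hw : ∀ ω, 0 ≤ w ω) : GoodSide w (fun _ => true) := by
  refine ⟨hw, fun V _ => ?_⟩
  have h0 : ∀ V' : Ω → Bool, blk w (fun _ => true) false V' = 0 := by
    intro V'
    unfold blk
    refine Finset.sum_eq_zero fun ω _ => ?_
    simp
  rw [h0, h0, mul_zero, mul_zero]


end ConstTrue

section Base

/-- THE BASE SIDE: a single edge of weight `y` between the terminals (`Ω = Bool` = edge absent/present,
`w false = q·q` (two components), `w true = y·q`, event `c = id`) is good whenever `0 ≤ q` and `0 ≤ y`. [this work] -/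
theorem goodSide_edge (q y : R) (hq : 0 ≤ q) (hy : 0 ≤ y) :
    GoodSide (fun b : Bool => if b then y * q else q * q) (fun b => b) := by
  refine ⟨fun b => ?_, fun V hV => ?_⟩
  · cases b
    · simpa using mul_nonneg hq hq
    · simpa using mul_nonneg hy hq
  · have hle : V false ≤ V true := hV (Bool.false_le _)
    cases hf : V false <;> cases ht : V true
    · simp [blk, top, hf, ht]
    · simpa [blk, top, hf, ht] using mul_nonneg (mul_nonneg hy hq) (mul_nonneg hq hq)
    · rw [hf, ht] at hle
      exact absurd hle (by decide)
    · simp [blk, top, hf, ht]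

end Base

section SeriesParallel

/-- A bundled side: a finite preordered configuration type with weights and a Boolean event. [this work] -/
structure BSide (R : Type*) [CommRing R] where
  /-- configurations -/
  Ω : Type
  /-- finiteness -/
  [fin : Fintype Ω]
  /-- the configuration order (coordinatewise inclusion for graphs) -/
  [ord : Preorder Ω]
  /-- weights -/
  w : Ω → R
  /-- the distinguished event (terminals connected) -/
  c : Ω → Bool

/-- the configuration type of a bundled side is finite (its own field; no library instance is overridden). -/
instance BSide.instFintype (S : BSide R) : Fintype S.Ω := S.fin

/-- the configuration type of a bundled side is preordered (its own field). -/
instance BSide.instPreorder (S : BSide R) : Preorder S.Ω := S.ord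

/-- Series–parallel TERMS: a single edge of weight `y`, or the series / parallel composition of two terms.  Every
two-terminal series–parallel network is the value of such a term. [this work] -/
inductive SPTerm (R : Type*) : Type _
  | edge (y : R) : SPTerm R
  | ser (s t : SPTerm R) : SPTerm R
  | par (s t : SPTerm R) : SPTerm R

variable (q : R)

/-- The side of a series–parallel term: configurations = edge subsets (iterated products of `Bool`), event = 'the two
terminals are connected', weight = `q^{n(t)} · Π_{e ∈ ω} y_e · q^{k(ω)}` where `k` is the number of connected components
and `n(t) = #ser + 2·#par` is a normalising power of `q` (series: `k = k₁ + k₂ − 1`, encoded with the trivial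
twist; parallel: `k = k₁ + k₂ − 2 + [c₁][c₂]`, encoded with the twist `q^{[c₁][c₂]}`).  The inequality `GoodSide` is
homogeneous of degree two in the weights, so in any ring where multiplication by `q` reflects the order (`ℝ` with `q > 0`,
`ℤ[q, y]` coefficientwise) the normalisation does not affect it. [this work] -/
def SPTerm.side : SPTerm R → BSide R
  | .edge y => { Ω := Bool, w := fun b => if b then y * q else q * q, c := fun b => b }
  | .ser s t =>
      { Ω := (s.side).Ω × (t.side).Ω,
        w := twistW (s.side).w (s.side).c (t.side).w (t.side).c (fun _ _ => 1),
        c := andC (s.side).c (t.side).c }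
  | .par s t =>
      { Ω := (s.side).Ω × (t.side).Ω,
        w := twistW (s.side).w (s.side).c (t.side).w (t.side).c (fun a b => if a && b then q else 1),
        c := orC (s.side).c (t.side).c }

omit [PartialOrder R] [IsOrderedRing R] in
/-- All edge weights of a term are nonnegative. [this work] -/
def SPTerm.Nonneg : SPTerm R → Prop
  | .edge y => 0 ≤ y
  | .ser s t => s.Nonneg ∧ t.Nonneg
  | .par s t => s.Nonneg ∧ t.Nonneg

/-- THEOREM A (memo §1): the side of every series–parallel term with nonnegative edge weights is good (`0 ≤ q`).  Over
`R = ℤ[q, (y_e)]` with the coefficientwise order: for every two-terminal series–parallel network `(N; x, y)` and every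
increasing event `𝒱`, `Z[x~y ∧ 𝒱]·Z[⊤] − Z[x~y]·Z[𝒱]` has nonnegative coefficients in `q` and in all edge variables.
[this work] -/
theorem SPTerm.goodSide (hq : 0 ≤ q) : ∀ t : SPTerm R, t.Nonneg → GoodSide (t.side q).w (t.side q).c
  | .edge y, hy => goodSide_edge q y hq hy
  | .ser s t, hst =>
      goodSide_twist_and _ _ _ _ (fun _ _ => 1) (fun _ _ => zero_le_one)
        (SPTerm.goodSide hq s hst.1) (SPTerm.goodSide hq t hst.2)
  | .par s t, hst =>
      goodSide_twist_or _ _ _ _ (fun a b => if a && b then q else 1)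
        (fun a b => by cases a <;> cases b <;> simp [hq])
        (SPTerm.goodSide hq s hst.1) (SPTerm.goodSide hq t hst.2)

/-- THEOREM A in Harris form: for a series–parallel term `t` with nonnegative weights, `0 ≤ q`, and any up-set `V` of its
configurations, `P(V)·(P(⊤)+Q(⊤)) − P(⊤)·(P(V)+Q(V)) ≥ 0`, i.e. `Z[c ∧ V]·Z − Z[c]·Z[V] ≥ 0`. [this work] -/
theorem SPTerm.harrisForm_nonneg (hq : 0 ≤ q) (t : SPTerm R) (ht : t.Nonneg) (V : (t.side q).Ω → Bool)
    (hV : Monotone V) :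
    0 ≤ blk (t.side q).w (t.side q).c true V
          * (blk (t.side q).w (t.side q).c true top + blk (t.side q).w (t.side q).c false top)
        - blk (t.side q).w (t.side q).c true top
          * (blk (t.side q).w (t.side q).c true V + blk (t.side q).w (t.side q).c false V) :=
  TwoCopyTwistedProduct.harrisForm_nonneg (SPTerm.goodSide q hq t ht) V hV

end SeriesParallel

end TwoCopySeriesParallel

end Summit.CriticalPhenomena.PercolationContinuityZ3.Theorems
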